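import Summits.BirchSwinnertonDyer.BirchSwinnertonDyer.Theorems.ThetaPartnerAtTwoSignedTransportAtTwoResidualRank
import Summits.BirchSwinnertonDyer.BirchSwinnertonDyer.Theorems.ThetaPartnerAtTwoSignedTransportAtTwoUnitOfInvariantsTwo
import Mathlib.Algebra.Module.Torsion.Basic
import Mathlib.LinearAlgebra.TensorProduct.RightExactness
import Mathlib.RingTheory.Ideal.Quotient.Index
import HarnessLib

/-!
# `p^{λ(M)} ≤ #(M/pM)` for EVERY finitely generated `ℤ_p`-module with a compatible `Λ`-structure — no torsion-freeness,
# no «no finite submodule», no control theorem (the T2 algebra of the lower-bound road for (R≥)ᵖ; kernel)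

Route `ResidualThetaTransportAtTwo` (RTT), crux (R≥)ᵖ `ResidualThetaCountLowerPureAtTwo` (stmt-BirchSwinnertonDyer-26074); seat
`prover-bsd-wall-rtt-p2` g9 (`--supports`, closes nothing). This is the «First lemma» `LambdaLeCardModTwo` named by crux idea card
`Cruxes/ResidualThetaCountLowerPureAtTwo/Ideas/gl1-plus-selmer-jlk-basechange.md` (ideator #1, 07:16Z), proved at every prime and
in the card's exact `p = 2` shape. HONEST FRAMING: THEOREMS ONLY (no definition, no named fact, no instance, no `sorry`); pure
commutative algebra over `ℤ_p`; nothing about any Selmer group; BSD is not proved by any of this.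

WHY. A LOWER bound `2^(λ + Σ) ≤ #R` only needs `2^{λ(X)} ≤ #(X/2X)`, which holds for every finitely generated `ℤ₂`-module `X`
(torsion only ENLARGES `X/2X`) — in contrast with the equality `#(X/pX) = p^{λ(X)}` (tree `SignedTransportAtTwo.natCard_quotient_eq_pow_lambdaInvariant`,
which needs «no `p`-torsion» = no finite `Λ`-submodule, a Greenberg-type input unprinted for `±` at `2`). So the `≥` road
(ROAD B/C, card C1's T2) needs no finite-submodule theorem and no control.

WHAT (`p` any prime; `M` a finitely generated `ℤ_p`-module; for the `λ`-statements also a `Λ = ℤ_p⟦T⟧`-structure with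
`IsScalarTower ℤ_p Λ M`, so that `λ(M) = dim_{ℚ_p}(ℚ_p ⊗_{ℤ_p} M)` by `SignedTransportAtTwo.lambdaInvariant_eq_finrank`):
* `subsingleton_baseChange_torsion` — `ℚ_p ⊗_{ℤ_p} T = 0` for the torsion submodule `T`;
* `finrank_baseChange_eq_finrank_quotientTorsion` — `dim_{ℚ_p}(ℚ_p ⊗ M) = rank_{ℤ_p}(M/T)` (`ℚ_p ⊗ M ≅ ℚ_p ⊗ (M/T)` by right
  exactness, and `M/T` is free);
* `finite_quotient_span_smul_top` — `M/pM` is finite; **`pow_finrank_baseChange_le_natCard_quotient`** — `p^{dim ℚ_p ⊗ M} ≤ #(M/pM)`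
  (`M/pM ↠ (M/T)/p(M/T)`, whose order is `p^{rank}` by the tree's `natCard_quotient_span_smul_top`);
* **`pow_lambdaInvariant_le_natCard_quotient`** — `p^{λ(M)} ≤ #(M ⧸ (p)·M)` and **`pow_lambdaInvariant_le_natCard_quotient_range_lsmul`**
  — the card's shape `p ^ lambdaInvariant p M ≤ Nat.card (M ⧸ LinearMap.range (LinearMap.lsmul ℤ_[p] M p))`; at `p = 2`:
  **`two_pow_lambdaInvariant_le_natCard_quotient`** (= `LambdaLeCardModTwo` verbatim).

References: [Washington1997] §13.2 (structure of finitely generated `Λ`-modules, `λ` as a `ℤ_p`-rank); [Matsuno2008] Lemma 4.3;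
[GreenbergVatsal2000] §2 p. 28.
-/

set_option autoImplicit false
-- the Theorems namespace of this sub repeats the summit name by design (D-0017 nested layout)
set_option linter.dupNamespace false

noncomputable section

open scoped TensorProduct Pointwise

open Literature.NumberTheory.EllipticCurves

namespace Summit.BirchSwinnertonDyer.BirchSwinnertonDyer.Theorems.LambdaLowerBound

universe u

variable (p : ℕ) [Fact p.Prime]

/-- **`ℚ_p ⊗_{ℤ_p} T = 0` for a `ℤ_p`-torsion module** (`q ⊗ t = (q/a) ⊗ a·t = 0`). [folklore] -/
theorem subsingleton_baseChange_torsion (M : Type u) [AddCommGroup M] [Module ℤ_[p] M] :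
    Subsingleton (ℚ_[p] ⊗[ℤ_[p]] (Submodule.torsion ℤ_[p] M)) := by
  refine ⟨fun z w ↦ ?_⟩
  suffices h : ∀ z : ℚ_[p] ⊗[ℤ_[p]] (Submodule.torsion ℤ_[p] M), z = 0 by rw [h z, h w]
  intro z
  induction z using TensorProduct.induction_on with
  | zero => rfl
  | tmul q t =>
    obtain ⟨a, ha⟩ := (Submodule.mem_torsion_iff (t : M)).mp t.2
    have ha0' : (a : ℤ_[p]) ≠ 0 := nonZeroDivisors.coe_ne_zero a
    have ha0 : ((a : ℤ_[p]) : ℚ_[p]) ≠ 0 := by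
      intro h
      apply ha0'
      exact PadicInt.coe_eq_zero.mp h
    have hq : q = (a : ℤ_[p]) • (q / ((a : ℤ_[p]) : ℚ_[p])) := by
      rw [Algebra.smul_def]
      change q = ((a : ℤ_[p]) : ℚ_[p]) * (q / ((a : ℤ_[p]) : ℚ_[p]))
      field_simp
    have hat : (a : ℤ_[p]) • t = 0 := by
      apply Subtype.ext
      change (a : ℤ_[p]) • (t : M) = 0
      exact ha
    rw [hq, TensorProduct.smul_tmul, hat, TensorProduct.tmul_zero]
  | add x y hx hy => rw [hx, hy, add_zero]

/-- **`dim_{ℚ_p}(ℚ_p ⊗ M) = rank_{ℤ_p}(M/T)`**, `T` the torsion submodule: `ℚ_p ⊗ M → ℚ_p ⊗ (M/T)` is surjective (right exactness)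
and injective (its kernel is the image of `ℚ_p ⊗ T = 0`), and `M/T` is finitely generated torsion-free, hence free, over the PID `ℤ_p`.
[cite: Washington1997, §13.2] -/
theorem finrank_baseChange_eq_finrank_quotientTorsion (M : Type u) [AddCommGroup M] [Module ℤ_[p] M] [Module.Finite ℤ_[p] M] :
    Module.finrank ℚ_[p] (ℚ_[p] ⊗[ℤ_[p]] M) =
      Module.finrank ℤ_[p] (M ⧸ Submodule.torsion ℤ_[p] M) := by
  set T := Submodule.torsion ℤ_[p] M with hT
  haveI : Module.Free ℤ_[p] (M ⧸ T) := Module.free_of_finite_type_torsion_free'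
  have hexact := lTensor_exact ℚ_[p] (LinearMap.exact_subtype_mkQ T) (Submodule.mkQ_surjective T)
  have hsurj : Function.Surjective ((Submodule.mkQ T).lTensor ℚ_[p]) :=
    LinearMap.lTensor_surjective ℚ_[p] (Submodule.mkQ_surjective T)
  have hinj : Function.Injective ((Submodule.mkQ T).lTensor ℚ_[p]) := by
    haveI := subsingleton_baseChange_torsion p M
    rw [← LinearMap.ker_eq_bot, LinearMap.exact_iff.mp hexact, LinearMap.range_eq_bot]
    exact Subsingleton.elim _ _
  -- the same map, `ℚ_p`-linearly
  have hbij : Function.Bijective ((Submodule.mkQ T).baseChange ℚ_[p]) := by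
    rw [Function.Bijective, LinearMap.baseChange_eq_ltensor]
    exact ⟨hinj, hsurj⟩
  rw [(LinearEquiv.ofBijective _ hbij).finrank_eq]
  exact Module.finrank_baseChange

/-- `M/pM` is finite for a finitely generated `ℤ_p`-module `M`. [folklore] -/
theorem finite_quotient_span_smul_top (M : Type u) [AddCommGroup M] [Module ℤ_[p] M] [Module.Finite ℤ_[p] M] :
    Finite (M ⧸ (Ideal.span {(p : ℤ_[p])} • (⊤ : Submodule ℤ_[p] M))) := by
  haveI : Finite (ℤ_[p] ⧸ Ideal.span {(p : ℤ_[p])}) :=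
    Nat.finite_of_card_ne_zero (by rw [SignedTransportAtTwo.natCard_padicInt_quotient_span]; exact (Fact.out : p.Prime).ne_zero)
  haveI : Finite (M ⧸ (⊤ : Submodule ℤ_[p] M)) := by
    haveI : Subsingleton (M ⧸ (⊤ : Submodule ℤ_[p] M)) := Submodule.Quotient.subsingleton_iff.mpr rfl
    infer_instance
  exact Submodule.finite_quotient_smul (Ideal.span {(p : ℤ_[p])}) Module.Finite.fg_top

/-- **`p^{dim_{ℚ_p}(ℚ_p ⊗ M)} ≤ #(M/pM)`** for every finitely generated `ℤ_p`-module `M`: `M/pM` maps onto `(M/T)/p(M/T)`, of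
order `p^{rank(M/T)}`. [cite: Washington1997, §13.2] -/
theorem pow_finrank_baseChange_le_natCard_quotient (M : Type u) [AddCommGroup M] [Module ℤ_[p] M] [Module.Finite ℤ_[p] M] :
    p ^ Module.finrank ℚ_[p] (ℚ_[p] ⊗[ℤ_[p]] M) ≤
      Nat.card (M ⧸ (Ideal.span {(p : ℤ_[p])} • (⊤ : Submodule ℤ_[p] M))) := by
  set T := Submodule.torsion ℤ_[p] M with hT
  set I : Ideal ℤ_[p] := Ideal.span {(p : ℤ_[p])} with hI
  haveI : Module.Free ℤ_[p] (M ⧸ T) := Module.free_of_finite_type_torsion_free'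
  haveI := finite_quotient_span_smul_top p M
  rw [finrank_baseChange_eq_finrank_quotientTorsion p M,
    ← SignedTransportAtTwo.natCard_quotient_span_smul_top p (M ⧸ T)]
  -- the surjection `M/IM → (M/T)/I(M/T)`
  have hle : I • (⊤ : Submodule ℤ_[p] M) ≤ (I • (⊤ : Submodule ℤ_[p] (M ⧸ T))).comap (Submodule.mkQ T) := by
    rw [← Submodule.map_le_iff_le_comap, Submodule.map_smul'', Submodule.map_top, Submodule.range_mkQ]
  refine Nat.card_le_card_of_surjective (Submodule.mapQ _ _ (Submodule.mkQ T) hle) ?_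
  rintro ⟨x⟩
  obtain ⟨y, rfl⟩ := Submodule.mkQ_surjective T x
  exact ⟨Submodule.Quotient.mk y, rfl⟩

/-- **`p^{λ(M)} ≤ #(M ⧸ (p)·M)`** for a `Λ`-module finitely generated over a compatible `ℤ_p`-structure (`λ` = the tree's
`lambdaInvariant`; no torsion-freeness / no-finite-submodule hypothesis). [cite: Washington1997, §13.2] -/
theorem pow_lambdaInvariant_le_natCard_quotient (M : Type u) [AddCommGroup M] [Module (IwasawaAlgebra p) M]
    [Module ℤ_[p] M] [IsScalarTower ℤ_[p] (IwasawaAlgebra p) M] [Module.Finite ℤ_[p] M] :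
    p ^ lambdaInvariant p M ≤ Nat.card (M ⧸ (Ideal.span {(p : ℤ_[p])} • (⊤ : Submodule ℤ_[p] M))) := by
  rw [SignedTransportAtTwo.lambdaInvariant_eq_finrank]
  exact pow_finrank_baseChange_le_natCard_quotient p M

/-- `(p)·M = pM = range(x ↦ p·x)` as `ℤ_p`-submodules. [folklore] -/
theorem span_smul_top_eq_range_lsmul (M : Type u) [AddCommGroup M] [Module ℤ_[p] M] :
    Ideal.span {(p : ℤ_[p])} • (⊤ : Submodule ℤ_[p] M) = LinearMap.range (LinearMap.lsmul ℤ_[p] M p) := by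
  ext x
  rw [Submodule.ideal_span_singleton_smul, Submodule.mem_smul_pointwise_iff_exists, LinearMap.mem_range]
  constructor
  · rintro ⟨y, -, rfl⟩; exact ⟨y, rfl⟩
  · rintro ⟨y, rfl⟩; exact ⟨y, Submodule.mem_top, rfl⟩

/-- **`p^{λ(M)} ≤ #(M ⧸ range(p·))`** — the idea card's shape (`LinearMap.lsmul`). [cite: Washington1997, §13.2] -/
theorem pow_lambdaInvariant_le_natCard_quotient_range_lsmul (M : Type u) [AddCommGroup M] [Module (IwasawaAlgebra p) M]
    [Module ℤ_[p] M] [IsScalarTower ℤ_[p] (IwasawaAlgebra p) M] [Module.Finite ℤ_[p] M] :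
    p ^ lambdaInvariant p M ≤ Nat.card (M ⧸ LinearMap.range (LinearMap.lsmul ℤ_[p] M p)) := by
  rw [← Nat.card_congr (Submodule.quotEquivOfEq _ _ (span_smul_top_eq_range_lsmul p M)).toEquiv]
  exact pow_lambdaInvariant_le_natCard_quotient p M

/-- **`LambdaLeCardModTwo`** (crux idea card `gl1-plus-selmer-jlk-basechange`, First lemma, verbatim shape): for every `Λ = ℤ₂⟦T⟧`-module
`M` finitely generated over a compatible `ℤ₂`-structure, `2 ^ λ(M) ≤ #(M ⧸ 2M)`. [cite: Washington1997, §13.2] -/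
theorem two_pow_lambdaInvariant_le_natCard_quotient :
    ∀ (M : Type) [AddCommGroup M] [Module (IwasawaAlgebra 2) M] [Module ℤ_[2] M]
      [IsScalarTower ℤ_[2] (IwasawaAlgebra 2) M] [Module.Finite ℤ_[2] M],
      2 ^ lambdaInvariant 2 M ≤ Nat.card (M ⧸ LinearMap.range (LinearMap.lsmul ℤ_[2] M 2)) := by
  intro M _ _ _ _ _
  exact_mod_cast pow_lambdaInvariant_le_natCard_quotient_range_lsmul 2 M

end Summit.BirchSwinnertonDyer.BirchSwinnertonDyer.Theorems.LambdaLowerBound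

end
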